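import Literature.Topology.FourManifolds.OneHandleStepPair
import HarnessLib

/-!
# The context of a handle slide: the handle-extension step with both sides equal

Topic `Literature/Topology/FourManifolds` (fact seat
`provefact-Literature.Topology.FourManifolds.lauden-f709dd520c`, Laudenbach–Poénaru's Lemma 2:
the diffeomorphisms `H₂` (flip) and `H₃` (slide) of a `1`-handlebody realising the elementary
Nielsen moves on `π₁` are produced by Milnor's handle-extension argument (proof of Thm. 3.13)
applied to *one* manifold on both sides — the data of
`Literature.Topology.FourManifolds.OneHandleStepContext` (`OneHandleStepContext.lean`) with
`M' = M`, equal handle sides, no level shift and the identity as seed).  Everything here is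
**proved**; no named facts.

* `SlideContext n M` — the one-sided half of `OneHandleStepContext`: a handle side `S`
  (`HandleConjugation.lean`) on the compact manifold with boundary `M` with the pinned constants
  of the step (`r = ε/10`, `γ = 32r⁴`, `a = f p - ε²/2`, `ℓ⁺ = f p + ε²`, `δ = ε²/100`,
  `ℓ₁ = c - 4τ`, `ℓ₂ = f p + 16ε²`, the inequalities between `ε, τ, η, c`), the index `k = 1`,
  `f` adapted to the boundary, no critical point other than `p` above `c - 5τ`, the seed level
  `c` connected, an orientation.
* `SlideContext.toCtx : OneHandleStepContext n M M` — both sides `S`, shift `σ = 0`, seed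
  `g₀ = g₀' = id` (smooth, level-preserving, self-inverse, and trivially related to the field).
  All the derived objects of `OneHandleStepContext.lean` / `OneHandleStepPair.lean` (unit slab
  `Sl`, flows `Λ`, transfer data `T`, feet discs `disc`, the handle pair `pair`, …) are thereby
  available for a slide context, with `toCtx.S' = S`, `toCtx.σ = 0` definitionally.
* `SlideContext.toCtx_match` — the matching condition of the step holds (the two families of
  discs coincide).

## References

* J. Milnor, *Lectures on the h-cobordism theorem* (1965), proof of Thm. 3.13 (PDF pp. 18–19).
  [MilnorHCobordism1965]
* F. Laudenbach, V. Poénaru, *A note on 4-dimensional handlebodies*, Bull. Soc. Math. France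
  100 (1972), proof of Lemma 2 (p. 340). [LaudenbachPoenaruBSMF1972]
-/

open scoped Manifold ContDiff Topology
open Set Function Filter Metric Module

noncomputable section

namespace Literature.Topology.FourManifolds

universe u

variable {n : ℕ} {M : Type u} [TopologicalSpace M] [ChartedSpace (EuclideanHalfSpace (n + 1)) M]
  [IsManifold (𝓡∂ (n + 1)) ∞ M]

variable (n M) in
/-- **The context of a handle slide / flip**: the one-sided data of the handle-extension step
(see the module docstring). [cite: MilnorHCobordism1965, proof of Thm. 3.13 (PDF pp. 18–19)] -/
structure SlideContext where
  /-- The handle side. -/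
  S : HandleSide (𝓡∂ (n + 1)) M
  hn : 2 ≤ n
  hF : IsMorseAdapted (𝓡∂ (n + 1)) S.f
  /-- The seed level. -/
  c : ℝ
  /-- The seed width. -/
  τ : ℝ
  τ_pos : 0 < τ
  hk : S.D.k = 1
  hr_eq : S.D.r = S.ε / 10
  hγ_eq : S.γ = 32 * S.D.r ^ 4
  ha_eq : S.a = S.f S.p - S.ε ^ 2 / 2
  hℓu_eq : S.ℓu = S.f S.p + S.ε ^ 2
  hδ_eq : S.δ = S.ε ^ 2 / 100
  hℓ₁_eq : S.ℓ₁ = c - 4 * τ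
  hℓ₂_eq : S.ℓ₂ = S.f S.p + 16 * S.ε ^ 2
  hε1 : S.ε ≤ 1 / 4
  hτε : τ ≤ S.ε ^ 2 / 100
  hηε : S.η ≤ S.ε ^ 2 / 100
  hητ : 9 * S.η ≤ τ
  hcτ : c + 8 * τ ≤ S.f S.p - 25 * S.ε ^ 2
  htop : S.f S.p + 17 * S.ε ^ 2 < 1
  hreg : ∀ x, c - 5 * τ ≤ S.f x → x ≠ S.p → ¬ IsMCriticalPt (𝓡∂ (n + 1)) S.f x
  hconn : IsConnected (S.f ⁻¹' {c})
  /-- An orientation of `M`. -/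
  oM : SmoothOrientation (𝓡∂ (n + 1)) M

namespace SlideContext

variable (C : SlideContext n M)

/-- **The two-sided context of a slide context**: both sides `S`, no shift, identity seed.
[cite: MilnorHCobordism1965, proof of Thm. 3.13 (PDF pp. 18–19)] -/
def toCtx : OneHandleStepContext n M M where
  S := C.S
  S' := C.S
  hn := C.hn
  hF := C.hF
  hF' := C.hF
  σ := 0
  c := C.c
  τ := C.τ
  τ_pos := C.τ_pos
  hk := C.hk
  hk' := C.hk
  hr := rfl
  hε := rfl
  hγ := rfl
  hη := rfl
  hδ := rfl
  ha := (add_zero _).symm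
  hℓ₁ := (add_zero _).symm
  hℓ₂ := (add_zero _).symm
  hℓu := (add_zero _).symm
  hfp := (add_zero _).symm
  hr_eq := C.hr_eq
  hγ_eq := C.hγ_eq
  ha_eq := C.ha_eq
  hℓu_eq := C.hℓu_eq
  hδ_eq := C.hδ_eq
  hℓ₁_eq := C.hℓ₁_eq
  hℓ₂_eq := C.hℓ₂_eq
  hε1 := C.hε1
  hτε := C.hτε
  hηε := C.hηε
  hητ := C.hητ
  hcτ := C.hcτ
  htop := C.htop
  htop' := C.htop
  hreg := C.hreg
  hreg' := fun y hy hyp => C.hreg y (by linarith) hyp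
  g₀ := id
  g₀' := id
  hg₀ := fun _ _ => contMDiffAt_id
  hg₀' := fun _ _ => contMDiffAt_id
  hlev₀ := fun _ _ => (add_zero _).symm
  hlev₀' := fun _ _ => (sub_zero _).symm
  hinv₀ := fun _ _ => rfl
  hinv₀' := fun _ _ => rfl
  hrel₀ := fun x _ => by
    show mfderiv (𝓡∂ (n + 1)) (𝓡∂ (n + 1)) id x (C.S.X x) = C.S.X x
    rw [mfderiv_id]; rfl
  hconn := C.hconn
  oM := C.oM
  oM' := C.oM

/-! ### Definitional unfoldings -/

/-- Both sides are `S`. [folklore] -/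
@[simp] theorem toCtx_S : C.toCtx.S = C.S := rfl
/-- Both sides are `S`. [folklore] -/
@[simp] theorem toCtx_S' : C.toCtx.S' = C.S := rfl
/-- No level shift. [folklore] -/
@[simp] theorem toCtx_σ : C.toCtx.σ = 0 := rfl
/-- The seed level. [folklore] -/
@[simp] theorem toCtx_c : C.toCtx.c = C.c := rfl
/-- The seed width. [folklore] -/
@[simp] theorem toCtx_τ : C.toCtx.τ = C.τ := rfl
/-- The seed is the identity. [folklore] -/
@[simp] theorem toCtx_g₀ : C.toCtx.g₀ = id := rfl
/-- The inverse seed is the identity. [folklore] -/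
@[simp] theorem toCtx_g₀' : C.toCtx.g₀' = id := rfl
/-- The two unit slabs coincide. [folklore] -/
theorem toCtx_Sl' : C.toCtx.Sl' = C.toCtx.Sl := rfl
/-- The two depths coincide. [folklore] -/
theorem toCtx_m' : C.toCtx.m' = C.toCtx.m := rfl

/-! ### The level diffeomorphism of the identity seed is the identity -/

/-- The level map of the identity seed is the identity on points. [folklore] -/
theorem toCtx_Ψlev_apply (v : C.toCtx.Sl.Level C.toCtx.c) :
    ((C.toCtx.Ψlev v : C.toCtx.Sl'.Level (C.toCtx.c + C.toCtx.σ)) : M) = (v : M) := rfl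

/-- **The two families of discs of the two-sided context coincide** (as maps into `M`).
[folklore] -/
theorem toCtx_disc_eq_disc' {s : ℝ} (hs : s ^ 2 = 1) (w : EuclideanSpace ℝ (Fin n)) :
    C.toCtx.disc hs w = C.toCtx.disc' hs w := by
  apply Subtype.ext; apply Subtype.ext
  show C.toCtx.Sl'.levelIncl (C.toCtx.disc hs w) = C.toCtx.Sl'.levelIncl (C.toCtx.disc' hs w)
  have h1 : C.toCtx.Sl'.levelIncl (C.toCtx.disc hs w) =
      C.S.θ (C.toCtx.c - (C.S.f C.S.p - C.toCtx.m), C.S.D.foot s C.toCtx.m C.toCtx.ρ w) := rfl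
  have h2 : C.toCtx.Sl'.levelIncl (C.toCtx.disc' hs w) =
      C.S.θ (C.toCtx.c + C.toCtx.σ - (C.S.f C.S.p - C.toCtx.m'), C.S.D.foot s C.toCtx.m' C.toCtx.ρ w) := rfl
  rw [h1, h2, toCtx_m', toCtx_σ, add_zero]

/-- The two families of discs coincide (as functions). [folklore] -/
theorem toCtx_disc_eq {s : ℝ} (hs : s ^ 2 = 1) : C.toCtx.disc hs = C.toCtx.disc' hs :=
  funext fun w => C.toCtx_disc_eq_disc' hs w

/-- **The matching condition holds for a slide context.** [folklore] -/
theorem toCtx_match : C.toCtx.Match :=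
  ⟨fun o₀ => by rw [C.toCtx_disc_eq (one_pow 2)]⟩

end SlideContext

end Literature.Topology.FourManifolds
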